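import Summits.BirchSwinnertonDyer.BirchSwinnertonDyer.Theorems.ErratumRoadFiveEulerHalfGenusJetchevBookkeeping
import Summits.BirchSwinnertonDyer.BirchSwinnertonDyer.Theorems.ClassRecordThreeCornerAtThreeJetchevWalkAbstractRedefinition
import HarnessLib

/-!
# Route `ErratumRoadFive`, crux `EulerHalfPOnlyMultPotMultTwinAtFive` (23444), line `genus`, child (b)
# `GenusKolyvaginPointDivAtP`: the FRAME-FREE road-K bridge (p704151) with McCallum Prop. 5.2 (`h52`, the r-graded
# `IsLeast` shape) REPLACED by the SWAP SUPPLY in Kolyvagin's «redefinition» currency (`hswap`, the binder shape of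
# CR3's `JET.Section6.exists_mInfty_of_swap` ∕ `ShimuraWalk.SwapSupplyAt`)
# (seat `bsd-idea-9` g27, line owner; helper `--supports stmt-BirchSwinnertonDyer-23444 --as helper`)

THEOREMS ONLY (no definition, no named fact, no `sorry`); no curve, no field, no Heegner point occurs in this file.
HONEST FRAMING: nothing here proves a divisibility; it proves that the frame-free road-K DEDUCTION
`GenusKolyvagin.FrameFree.pointFamily_divisible_of_prop52_of_prop53_of_thm63` (p704151) needs McCallum's Prop. 5.2 ONLY
through the existence of Kolyvagin's `m_∞` attained at conductors of arbitrarily large index — which is exactly what the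
swap supply delivers (`JET.Section6.exists_mInfty_of_swap`, `Theorems/ClassRecordThreeCornerAtThreeJetchevWalkAbstractRedefinition.lean`,
cell bsd-stepL).  BSD is proved for no curve; items 19715 ∕ 20529 ∕ 23444 stay open.

WHY (line-owner currency decision, bsd-stepL STATUS 2026-08-29 ≈17:25Z, answering `bsd-stepL-imc-p1` g42 16:52:18Z ∕ 17:06:38Z).
The genus line's child (b1) `GenusLine.GenusMcCallum52` is typed in McCallum's own shape (`r = ω(n)` fixed, `M_r` an `IsLeast`, level
raising within `ω = r`).  For the labelled genus family the SWAP SUPPLY is now a tree theorem on every served frame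
(`ShimuraWalk.genusSwapSupplyAt_of_frameProfile`, imc-p1 g42, over corner-p1's frame-generic `JET.Swap.shimuraWalk_swapSupplyAt_of_family`),
in the currency `∀ μ e c, M(c) ≥ μ+1 → (∀ c', M(c') ≥ μ+1 → μ ≤ m'(c')) → ¬ (μ+1 ≤ m'(c)) → ∃ c', M(c') ≥ e ∧ ¬ (μ+1 ≤ m'(c'))`, which
forgets `ω` and therefore does NOT give back the typed (b1).  Nothing downstream needs `ω`: in p704151 the binder `h52` is consumed at ONE
place (the step `hKoly : ∀ m', ∃ c, m' ≤ M(c) ∧ m(c) = m_∞`).  This file re-runs p704151 with that step fed by `exists_mInfty_of_swap`: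

* binders `hp, IsK, idx, Midx, hMidx, D, A, P, hA, Core, t, h53, h63` — VERBATIM those of p704151;
* `hswap` — for EVERY depth function `mdiv` on the conductor type `Λ = {c // Squarefree c ∧ ∀ ℓ ∣ c prime, IsK ℓ}` characterised by
  `u ≤ mdiv c ↔ every datum's point at c is p^u-divisible` (the same universal quantification over `(mdiv, hchar)` that `h63` carries, so
  that the supplier may prove it for ITS OWN depth function — `ShimuraWalk.mdiv` of the labelled family, transported by adapter A
  `GenusLine.forall_genusDatum_pDiv_iff_pDiv`, p730113), the swap statement above with `M := Midx`.

CONCLUSION (`pointFamily_divisible_of_swap_of_prop53_of_thm63`): as p704151 — every `P n d` with `n` square-free on `IsK`-primes of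
index `≥ s`, `s ≤ t`, is `p^s`-divisible.  PROOF: if some conductor has `m'(c) < M(c)`, `exists_mInfty_of_swap` gives `(m_∞, hmInf, hKoly)`
and p704151's tail runs verbatim (`exists_coreVertex_of_prop53` = [J] Prop. 6.4 from `h53`; `h63`; the abstract §6 end
`JET.Section6.tamagawaExponent_le_mInfty_of_coreVertices_min` ∘ `depth_le_mdiv_of_le_mInfty`); otherwise `s ≤ M(n) ≤ m'(n)` directly.
Pure order theory over the two landed abstract engines; ≈ 60 lines of proof.
[cite: Jetchev2008, Thm. 1.4 (p. 812), §3.1 item 5 (p. 817), Prop. 5.3 (p. 823), Thm. 5.2, proof of Thm. 1.1 (p. 824)]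
[cite: McCallumLMS1991, §5 Prop. 5.2 (pp. 304–306)] [cite: GrossLMS1991, §4 Lemma 4.3]
presearch: «Kolyvagin prime swap m_infinity redefinition abstract» → [corpus: Jetchev2008 §3.1 item 5, McCallumLMS1991 §5] frame-bound prose only;
`lean search 'exists_mInfty_of_swap'` → CR3's abstract engine (used BY NAME); `lean search 'of_swap_of_prop53'` → none.
-/

set_option autoImplicit false

noncomputable section

open scoped Classical

set_option linter.dupNamespace false

namespace Summit.BirchSwinnertonDyer.BirchSwinnertonDyer.Theorems.GenusKolyvagin.FrameFree

open Summit.BirchSwinnertonDyer.Rank1Residual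

/-- **Road K's deduction over an abstract family, SWAP-currency form**: McCallum Prop. 5.2 replaced by the swap supply `hswap`
(Kolyvagin's redefinition currency, universally over the characterised depth function), Jetchev Prop. 5.3 for the family (`h53`) and
[J] Thm. 6.3 for the rows (`h63`) give the `p^s`-divisibility of every point of the family whose square-free conductor lies on
`IsK`-primes of index `≥ s`, `s ≤ t`.  `h53`, `h63` and every other binder are VERBATIM those of
`pointFamily_divisible_of_prop52_of_prop53_of_thm63` (p704151); the step `(m_∞, hmInf, hKoly)` is `JET.Section6.exists_mInfty_of_swap`.
CONDITIONAL on the displayed hypotheses; nothing about any curve is asserted; BSD is proved for no curve.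
[cite: Jetchev2008, Thm. 1.4 (p. 812), §3.1 item 5, Prop. 5.3, proof of Thm. 1.1 (p. 824)] [cite: McCallumLMS1991, §5 Prop. 5.2 (p. 304)] -/
theorem pointFamily_divisible_of_swap_of_prop53_of_thm63
    {p : ℕ} (hp : p.Prime) (IsK : ℕ → Prop) (idx : ℕ → ℕ) (Midx : ℕ → ℕ∞)
    (hMidx : ∀ (c s : ℕ), (s : ℕ∞) ≤ Midx c ↔ ∀ ℓ ∈ c.primeFactors, s ≤ idx ℓ)
    {D : ℕ → Type*} {A : ℕ → Type*} [∀ c, AddCommGroup (A c)] (P : ∀ c, D c → A c)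
    (hA : ∀ c : ℕ, Squarefree c → (∀ ℓ ∈ c.primeFactors, IsK ℓ) → ∀ R : A c, (p : ℤ) • R = 0 → R = 0)
    (Core : ℕ → ℕ → Prop) (t : ℕ)
    (hswap : ∀ (mdiv : {c : ℕ // Squarefree c ∧ ∀ ℓ ∈ c.primeFactors, IsK ℓ} → ℕ∞),
      (∀ c (u : ℕ), (u : ℕ∞) ≤ mdiv c ↔ ∀ d : D c.1, ∃ Q : A c.1, ((p ^ u : ℕ) : ℤ) • Q = P c.1 d) →
      ∀ (μ e : ℕ) (c : {c : ℕ // Squarefree c ∧ ∀ ℓ ∈ c.primeFactors, IsK ℓ}),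
        ((μ + 1 : ℕ) : ℕ∞) ≤ Midx c.1 →
        (∀ c' : {c : ℕ // Squarefree c ∧ ∀ ℓ ∈ c.primeFactors, IsK ℓ},
          ((μ + 1 : ℕ) : ℕ∞) ≤ Midx c'.1 → (μ : ℕ∞) ≤ mdiv c') →
        ¬ ((μ + 1 : ℕ) : ℕ∞) ≤ mdiv c →
        ∃ c' : {c : ℕ // Squarefree c ∧ ∀ ℓ ∈ c.primeFactors, IsK ℓ},
          (e : ℕ∞) ≤ Midx c'.1 ∧ ¬ ((μ + 1 : ℕ) : ℕ∞) ≤ mdiv c')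
    (h53 : ∀ k : ℕ, 1 ≤ k → ∀ (c : ℕ) (d : D c), Squarefree c → (∀ ℓ ∈ c.primeFactors, IsK ℓ) →
      ∀ s : ℕ, ¬ IsOfFinAddOrder (P c d) → (∃ Q : A c, ((p ^ s : ℕ) : ℤ) • Q = P c d) →
      (¬ ∃ Q : A c, ((p ^ (s + 1) : ℕ) : ℤ) • Q = P c d) → ((s + k : ℕ) : ℕ∞) ≤ Midx c →
      ∃ (c' : ℕ) (d' : D c'), Squarefree c' ∧ (∀ ℓ ∈ c'.primeFactors, IsK ℓ ∧ k + s ≤ idx ℓ) ∧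
        Core k c' ∧ ¬ IsOfFinAddOrder (P c' d') ∧
        ¬ ∃ Q : A c', ((p ^ (s + 1) : ℕ) : ℤ) • Q = P c' d')
    (h63 : ∀ (mdiv m : {c : ℕ // Squarefree c ∧ ∀ ℓ ∈ c.primeFactors, IsK ℓ} → ℕ∞),
      (∀ c (u : ℕ), (u : ℕ∞) ≤ mdiv c ↔ ∀ d : D c.1, ∃ Q : A c.1, ((p ^ u : ℕ) : ℤ) • Q = P c.1 d) →
      (∀ c, m c = if mdiv c < Midx c.1 then mdiv c else ⊤) →
      ∀ mInf : ℕ, (∀ c, (mInf : ℕ∞) ≤ m c) →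
        (∀ m' : ℕ, ∃ c, (m' : ℕ∞) ≤ Midx c.1 ∧ m c = mInf) →
      ∀ (k : ℕ) c, 1 ≤ k → Core k c.1 → m c = mInf → (k : ℕ∞) + mInf ≤ Midx c.1 →
        t < k → mInf < k → t ≤ mInf)
    (s : ℕ) (hs : s ≤ t) (n : ℕ) (d : D n) (hn : Squarefree n)
    (hℓ : ∀ ℓ ∈ n.primeFactors, IsK ℓ ∧ s ≤ idx ℓ) :
    ∃ Q : A n, ((p ^ s : ℕ) : ℤ) • Q = P n d := by
  -- the conductor type and the divisibility predicate
  set Λ := {c : ℕ // Squarefree c ∧ ∀ ℓ ∈ c.primeFactors, IsK ℓ} with hΛ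
  let Dv : ∀ c : ℕ, ℕ → Prop := fun c u ↦ ∀ d : D c, ∃ Q : A c, ((p ^ u : ℕ) : ℤ) • Q = P c d
  have hDv0 : ∀ c, Dv c 0 := fun c d ↦ ⟨P c d, by simp⟩
  have hDvmono : ∀ c {u v : ℕ}, v ≤ u → Dv c u → Dv c v :=
    fun c u v huv h d ↦ JET.exists_pow_smul_eq_of_le p huv (h d)
  -- the depth function `m'(c)` and its characterisation (p704151 verbatim)
  let mdivN : ℕ → ℕ∞ := fun c ↦
    if h : ∃ u, ¬ Dv c u then ((Nat.find h - 1 : ℕ) : ℕ∞) else ⊤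
  have hchar : ∀ (c u : ℕ), (u : ℕ∞) ≤ mdivN c ↔ Dv c u := by
    intro c u
    by_cases h : ∃ u, ¬ Dv c u
    · have hfind0 : 0 < Nat.find h := by
        rw [Nat.find_pos]
        exact fun h0 ↦ h0 (hDv0 c)
      simp only [mdivN, dif_pos h, ENat.coe_le_coe]
      constructor
      · intro hu
        have hlt : u < Nat.find h := by omega
        have := (Nat.lt_find_iff h u).mp hlt u le_rfl
        simpa using this
      · intro hu
        have hlt : u < Nat.find h := by
          rw [Nat.lt_find_iff]
          intro v hv hnv
          exact hnv (hDvmono c hv hu)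
        omega
    · simp only [mdivN, dif_neg h, le_top, true_iff]
      exact not_not.mp (not_exists.mp h u)
  -- the functions on `Λ`
  let M : Λ → ℕ∞ := fun c ↦ Midx c.1
  let mdiv : Λ → ℕ∞ := fun c ↦ mdivN c.1
  let m : Λ → ℕ∞ := fun c ↦ if mdiv c < M c then mdiv c else ⊤
  have hm : ∀ c, mdiv c < M c → m c ≤ mdiv c := fun c h ↦ by
    simp only [m, if_pos h]
    exact le_rfl
  -- the target conductor as an element of `Λ`, and `s ≤ M(n)`
  let cn : Λ := ⟨n, hn, fun ℓ h ↦ (hℓ ℓ h).1⟩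
  have hsM : (s : ℕ∞) ≤ M cn := (hMidx n s).mpr fun ℓ h ↦ (hℓ ℓ h).2
  -- it suffices to bound the depth of conductor `n`
  suffices hgoal : (s : ℕ∞) ≤ mdiv cn from ((hchar n s).mp hgoal) d
  by_cases hfin : ∃ c : Λ, mdiv c < M c
  · -- Kolyvagin's `m_∞` from the swap supply (CR3's abstract engine)
    obtain ⟨mInf, hmInf, hKoly⟩ :=
      JET.Section6.exists_mInfty_of_swap M mdiv hfin (hswap mdiv fun c u ↦ hchar c.1 u)
    -- Prop. 6.4 (from `h53`) and Thm. 6.3 (`h63`) for these data (p704151 verbatim)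
    have h64 : ∀ (k : ℕ) (c : Λ), 1 ≤ k → m c = mInf → (mInf : ℕ∞) + k ≤ M c →
        ∃ c' : Λ, Core k c'.1 ∧ (k : ℕ∞) + mInf ≤ M c' ∧ m c' ≤ mInf :=
      fun k c hk hmc hMc ↦ exists_coreVertex_of_prop53 hp IsK idx Midx hMidx P hA Core h53 mdiv m
        (fun c u ↦ hchar c.1 u) (fun c ↦ rfl) mInf k c hk hmc hMc
    have h63' : ∀ (k : ℕ) (c : Λ), 1 ≤ k → Core k c.1 → m c = mInf → (k : ℕ∞) + mInf ≤ M c →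
        t < k → mInf < k → t ≤ mInf :=
      h63 mdiv m (fun c u ↦ hchar c.1 u) (fun c ↦ rfl) mInf hmInf hKoly
    -- §6 abstract end form (minimal-core-vertex variant)
    exact JET.Section6.depth_le_mdiv_of_le_mInfty M mdiv m hm mInf hmInf
      (JET.Section6.tamagawaExponent_le_mInfty_of_coreVertices_min M m (fun k c ↦ Core k c.1) t mInf
        hmInf hKoly h64 h63')
      s hs cn hsM
  · -- no conductor has a finite redefined depth: `s ≤ M(n) ≤ m'(n)`
    push Not at hfin
    exact hsM.trans (hfin cn)

end Summit.BirchSwinnertonDyer.BirchSwinnertonDyer.Theorems.GenusKolyvagin.FrameFree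

end
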